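import Summits.Ventures.CertifiedArithmetic.LowPrec.TwoSumCertificates

/-!
# Fast2Sum without its magnitude test: the exact failure counts on the FP6 formats

HONEST FRAMING (venture CertifiedArithmetic / cell `pub-lowprec`): certified error envelopes and
provably optimal rounding/accumulation schemes for low-precision formats under stated cost models;
every table by two implementations; no hardware or vendor claims.

`TwoSumCertificates.lean` (lean seat) counts the ordered `E2M1` pairs on which Dekker's Fast2Sum run
WITHOUT its test `|b| ≤ |a|` (`s = fl(a+b)`, `z = fl(s-a)`, `t = fl(b-z)`, saturating RNE) fails to
return the rounding error `a + b - s`: `28` of `256` (`fast2Sum_noTest_failures_E2M1`). This file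
adds the two FP6 counts — `E3M2`: `1192` of `4096`, `E2M3`: `592` of `4096` — each a kernel
evaluation of three roundings over all `64²` ordered pairs of finite data (`countPairs`, `decide
+kernel`). The same three numbers (and `0` failures on the pairs with `|b| ≤ |a|`, and 2Sum exact on
every pair) are produced by the cell's two table implementations A (values) and B (bit codes):
certificate `certs/enum/twosum/` of the cell (enum seat), 18 fields, 0 mismatches — so each count is
held three ways. (With the test, Fast2Sum never fails in any format: `fast2Sum_exact`,
ErrorFreeAdd.lean; the branch-free 2Sum never fails in any format: `twoSum_exact`, TwoSum.lean.)
-/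

namespace Literature.ComputerArithmetic.FloatingPoint

namespace MiniFloat

open Format

set_option maxHeartbeats 1600000 in
/-- Fast2Sum WITHOUT its magnitude test fails to return `a + b - s` on exactly `1192` of the `4096`
ordered `E3M2` pairs (saturating RNE; kernel count, heartbeat budget raised; = implementations A and
B of the cell). [folklore] -/
theorem fast2Sum_noTest_failures_E3M2 :
    Summit.Ventures.CertifiedArithmetic.countPairs E3M2 (fun a b =>
      !decide ((roundNE E3M2 (b.toRat - (roundNE E3M2 ((roundNE E3M2 (a.toRat + b.toRat)).toRat
          - a.toRat)).toRat)).toRat = a.toRat + b.toRat - (roundNE E3M2 (a.toRat + b.toRat)).toRat))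
      = 1192 := by
  decide +kernel

set_option maxHeartbeats 1600000 in
/-- Fast2Sum WITHOUT its magnitude test fails to return `a + b - s` on exactly `592` of the `4096`
ordered `E2M3` pairs (saturating RNE; kernel count, heartbeat budget raised; = implementations A and
B of the cell). [folklore] -/
theorem fast2Sum_noTest_failures_E2M3 :
    Summit.Ventures.CertifiedArithmetic.countPairs E2M3 (fun a b =>
      !decide ((roundNE E2M3 (b.toRat - (roundNE E2M3 ((roundNE E2M3 (a.toRat + b.toRat)).toRat
          - a.toRat)).toRat)).toRat = a.toRat + b.toRat - (roundNE E2M3 (a.toRat + b.toRat)).toRat))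
      = 592 := by
  decide +kernel

end MiniFloat

end Literature.ComputerArithmetic.FloatingPoint
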